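import Summits.ABC.IUTFork.Cor312StatementBridge
import Summits.ABC.IUTFork.Thm311LinkCompat
import HarnessLib

/-!
# [IUTchIII] Cor. 3.12 — re-choosing the Θ-glue at ONE packet: the (G3) countermodel is UNIFORM in the
# Theorem 3.11 instance

Record-only file (D-0012) of the abc-iut cell (Cor. 3.12 cone, D-0067; support piece for TEAM A row A-4 /
ADJUDICATION-SPEC §2 (G3), §4 (iii) grading; wave-5 seat abc-iut-w5-d177); TAKES NO SIDE; two bookkeeping
`def`s (`Cor312.Setting.reglue`, `Cor312.Setting.familyOf`), one hypothesis-`def` (`SmallStableHullSets`,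
never asserted) and theorems; no `Prop` fact.

The (G3) witnesses of record (`Cor312TeamAGapWitness(B)`, `Cor312GapWitnessProvenance`, the staged
`Cor312TeamAGapWitnessNV`) EXHIBIT settings where the typed Theorem 3.11, every bridge hypothesis and
`|log(q)| > 0` hold while the typed Corollary 3.12 fails; w4-d041's SPEC COMMENT (INBOX 2026-08-26T00:17:04Z)
asks to grade how DEGENERATE their Theorem 3.11 instance is. THIS FILE proves the grade is immaterial:
* `Cor312.Setting.reglue P j₀ vQ₀ R` — `P` with ONLY the Θ-glue field `thetaRegionOf` (RESIDUAL R1 of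
  `Cor312Statement`) re-chosen at the ONE packet `(j₀, vQ₀)`; column, lattice, Prop. 3.7 signature, splitting
  monoids, `q`-pilot data, frames, `q`-glue and the underlying `Thm311.Situation` are untouched (`rfl`s).
* `reglue_thetaLocal_of_ne` / `reglue_thetaLocal_self`, `reglue_negLogTheta` — off the edited packet nothing
  changes; at it, for an (Ind1),(Ind2)-STABLE hull-set admitting a hull, the packet hull IS the new region, and
  `−|log(Θ)|` moves by `(logvol R − old local volume)/l⋇`; `reglue_bridgeHyps` — the bridge hypotheses survive.
* **`exists_reglue_not_statement`**, **`thm311_any_instance_not_imp_statement`** — for EVERY `T`, EVERY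
  `F : Thm311.FullSituation T` (degenerate or contentful, `F.Statement` or not — the assembled real one
  included) and EVERY setting `P` over `F` with `BridgeHyps P`, `AbsLogQPos P` and, at one packet, stable
  hull-sets admitting a hull of arbitrarily negative log-volume (`SmallStableHullSets`, the shape of the balls
  `λ·𝒪`, `λ → 0`; HYPOTHESIS, discharged here for no instance), some re-gluing `P'` of `P` at that packet — over
  THE SAME `F` — has `BridgeHyps P' ∧ P'.AbsLogQPos ∧ ¬ P'.Statement`. Hence no property of the Theorem 3.11
  instance (splitting monoids, shells, Kummer isomorphisms, link data) can by itself entail the typed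
  Corollary; an entailment must consume a constraint tying `thetaRegionOf` to those data — the shape of
  Team A's gap statement of record `Cor312Vol.SoundAtInput` (GAP-LEDGER G-c312-9-1): the (G) finding, stated
  uniformly. HONEST SCOPE: about OUR typed interfaces (the glue is a free field of the frozen `Setting`);
  nothing about the intended Kummer-isomorphism glue — that is the dispute, untouched.
  [claim: Mochizuki2012, status: disputed] [cite: ScholzeStix2018, §2.2 pp. 9–10]
Deliberately NOT here: an instance of `SmallStableHullSets` (companion file); any judgement on (xi-f).
-/
noncomputable section

namespace Summit.ABC

namespace IUTFork

namespace Cor312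

namespace Setting

open Thm311 Literature.IUT.LogThetaLattice

variable {T : ThetaIndex} {S : Situation T} (P : Setting S)

/-! ## 1. Re-choosing the Θ-glue at one packet -/

open scoped Classical in
/-- **The setting `P` with ONLY its Θ-glue re-chosen at the packet `(j₀, vQ₀)`**: there the region attached to
every object of `†𝒞^⊩_lgp` at every lattice index `m` is `R j₀ vQ₀`; everywhere else, and in every other
field, it is `P`. (The family `R` is read only at `(j₀, vQ₀)`.) [folklore] -/
def reglue (j₀ : T.Label) (vQ₀ : T.VQ) (R : ∀ (j : T.Label) (vQ : T.VQ), Set (S.L.Packet j vQ)) :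
    Setting S :=
  { P with
    thetaRegionOf := fun m x j vQ =>
      if j = j₀ ∧ vQ = vQ₀ then R j vQ else P.thetaRegionOf m x j vQ }

section Reglue

open scoped Classical

variable (j₀ : T.Label) (vQ₀ : T.VQ) (R : ∀ (j : T.Label) (vQ : T.VQ), Set (S.L.Packet j vQ))

/-- `−|log(q)|` is unchanged. [folklore] -/
theorem reglue_negLogQ : (P.reglue j₀ vQ₀ R).negLogQ = P.negLogQ := rfl

/-- "`|log(q)| > 0`" is unchanged. [folklore] -/
theorem reglue_absLogQPos_iff : (P.reglue j₀ vQ₀ R).AbsLogQPos ↔ P.AbsLogQPos := Iff.rfl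

/-- At the edited packet the (Ind3)-enlarged region is the new region. [folklore] -/
theorem reglue_thetaRegion3_self : (P.reglue j₀ vQ₀ R).thetaRegion3 j₀ vQ₀ = R j₀ vQ₀ := by
  show (⋃ m : ℤ, if j₀ = j₀ ∧ vQ₀ = vQ₀ then R j₀ vQ₀ else P.thetaRegionOf m P.thetaPilot j₀ vQ₀) = R j₀ vQ₀
  simp only [and_self, if_true]
  exact Set.iUnion_const _

/-- Off the edited packet the (Ind3)-enlarged regions are `P`'s. [folklore] -/
theorem reglue_thetaRegion3_of_ne {j : T.Label} {vQ : T.VQ} (h : ¬ (j = j₀ ∧ vQ = vQ₀)) :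
    (P.reglue j₀ vQ₀ R).thetaRegion3 j vQ = P.thetaRegion3 j vQ := by
  show (⋃ m : ℤ, if j = j₀ ∧ vQ = vQ₀ then R j vQ else P.thetaRegionOf m P.thetaPilot j vQ) =
    ⋃ m : ℤ, P.thetaRegion m j vQ
  simp only [if_neg h]
  rfl

/-- Off the edited packet the possible images are `P`'s. [folklore] -/
theorem reglue_possibleImages_of_ne {j : T.Label} {vQ : T.VQ} (h : ¬ (j = j₀ ∧ vQ = vQ₀)) :
    (P.reglue j₀ vQ₀ R).possibleImages j vQ = P.possibleImages j vQ := by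
  unfold possibleImages
  rw [P.reglue_thetaRegion3_of_ne j₀ vQ₀ R h]

/-- At the edited packet, if the new region is (Ind1),(Ind2)-STABLE, the possible images are exactly `{R}`.
[folklore] -/
theorem reglue_possibleImages_self (hst : ∀ Φ ∈ indGroup S, Φ j₀ vQ₀ '' R j₀ vQ₀ = R j₀ vQ₀) :
    (P.reglue j₀ vQ₀ R).possibleImages j₀ vQ₀ = {R j₀ vQ₀} := by
  ext U
  simp only [possibleImages, reglue_thetaRegion3_self, Set.mem_setOf_eq, Set.mem_singleton_iff]
  constructor
  · rintro ⟨Φ, hΦ, rfl⟩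
    exact hst Φ hΦ
  · rintro rfl
    exact ⟨1, (indGroup S).one_mem, by simp⟩

/-- Off the edited packet the packet hulls are `P`'s. [folklore] -/
theorem reglue_thetaHull_of_ne {j : T.Label} {vQ : T.VQ} (h : ¬ (j = j₀ ∧ vQ = vQ₀)) :
    (P.reglue j₀ vQ₀ R).thetaHull j vQ = P.thetaHull j vQ := by
  unfold thetaHull
  rw [P.reglue_possibleImages_of_ne j₀ vQ₀ R h]
  rfl

/-- Off the edited packet the local Θ-volumes are `P`'s. [folklore] -/
theorem reglue_thetaLocal_of_ne {j : T.Label} {vQ : T.VQ} (h : ¬ (j = j₀ ∧ vQ = vQ₀)) :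
    (P.reglue j₀ vQ₀ R).thetaLocal j vQ = P.thetaLocal j vQ := by
  unfold thetaLocal HullDefined
  rw [P.reglue_thetaHull_of_ne j₀ vQ₀ R h, P.reglue_possibleImages_of_ne j₀ vQ₀ R h]
  rfl

/-- At the edited packet, for an (Ind1),(Ind2)-stable new region that is a hull-set, the packet hull
`^{n,∘}𝒰_{j₀,v_ℚ⁰}` IS the new region. [folklore] -/
theorem reglue_thetaHull_self (hst : ∀ Φ ∈ indGroup S, Φ j₀ vQ₀ '' R j₀ vQ₀ = R j₀ vQ₀)
    (hHul : R j₀ vQ₀ ∈ (P.frame j₀ vQ₀).Hul) :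
    (P.reglue j₀ vQ₀ R).thetaHull j₀ vQ₀ = R j₀ vQ₀ := by
  unfold thetaHull
  rw [P.reglue_possibleImages_self j₀ vQ₀ R hst, Set.sUnion_singleton]
  exact Set.Subset.antisymm ((P.frame j₀ vQ₀).hull_subset_of_mem hHul subset_rfl)
    ((P.frame j₀ vQ₀).subset_hull _)

/-- At the edited packet, for an (Ind1),(Ind2)-stable hull-set admitting a hull, `HullDefined` holds.
[folklore] -/
theorem reglue_hullDefined_self (hst : ∀ Φ ∈ indGroup S, Φ j₀ vQ₀ '' R j₀ vQ₀ = R j₀ vQ₀)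
    (hHul : R j₀ vQ₀ ∈ (P.frame j₀ vQ₀).Hul) (hHas : (P.frame j₀ vQ₀).HasHull (R j₀ vQ₀)) :
    (P.reglue j₀ vQ₀ R).HullDefined j₀ vQ₀ := by
  unfold HullDefined
  rw [P.reglue_possibleImages_self j₀ vQ₀ R hst, Set.sUnion_singleton]
  exact ⟨(P.frame j₀ vQ₀).hul_bounded _ hHul, hHas⟩

/-- At the edited packet, for an (Ind1),(Ind2)-stable hull-set admitting a hull, the local Θ-volume is the
log-volume of the new region. [folklore] -/
theorem reglue_thetaLocal_self (hst : ∀ Φ ∈ indGroup S, Φ j₀ vQ₀ '' R j₀ vQ₀ = R j₀ vQ₀)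
    (hHul : R j₀ vQ₀ ∈ (P.frame j₀ vQ₀).Hul) (hHas : (P.frame j₀ vQ₀).HasHull (R j₀ vQ₀)) :
    (P.reglue j₀ vQ₀ R).thetaLocal j₀ vQ₀ =
      (((S.D P.n).logvol j₀ vQ₀ (R j₀ vQ₀) : ℝ) : WithTop ℝ) := by
  unfold thetaLocal
  rw [if_pos (P.reglue_hullDefined_self j₀ vQ₀ R hst hHul hHas), P.reglue_thetaHull_self j₀ vQ₀ R hst hHul]
  rfl

end Reglue

/-! ## 2. Re-gluing at a label in `𝔽_l^⋇`: the family, `ThetaFinite`, and the exact effect on `−|log(Θ)|` -/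

section AtLabel

open scoped Classical

variable {P}
variable (i₀ : Fin T.lstar) (vQ₀ : T.VQ) (R : ∀ (j : T.Label) (vQ : T.VQ), Set (S.L.Packet j vQ))

/-- Index bookkeeping: off `(i₀, vQ₀)` the packet `(labelSucc i, vQ)` is not the edited one (`labelSucc` is
injective). [folklore] -/
theorem not_edited_of_ne {i : Fin T.lstar} {vQ : T.VQ} (h : ¬ (i = i₀ ∧ vQ = vQ₀)) :
    ¬ (labelSucc i = labelSucc i₀ ∧ vQ = vQ₀) := by
  rintro ⟨h1, h2⟩
  exact h ⟨Fin.succ_inj.mp h1, h2⟩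

/-- `ThetaFinite` ("`−|log(Θ)|` is finite") survives re-gluing at one packet by an (Ind1),(Ind2)-stable hull-set
admitting a hull: one local volume is replaced by a real number. [folklore] -/
theorem reglue_thetaFinite (hfin : P.ThetaFinite)
    (hst : ∀ Φ ∈ indGroup S, Φ (labelSucc i₀) vQ₀ '' R (labelSucc i₀) vQ₀ = R (labelSucc i₀) vQ₀)
    (hHul : R (labelSucc i₀) vQ₀ ∈ (P.frame (labelSucc i₀) vQ₀).Hul)
    (hHas : (P.frame (labelSucc i₀) vQ₀).HasHull (R (labelSucc i₀) vQ₀)) :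
    (P.reglue (labelSucc i₀) vQ₀ R).ThetaFinite := by
  refine ⟨fun i vQ => ?_, fun i => ?_⟩
  · by_cases h : i = i₀ ∧ vQ = vQ₀
    · obtain ⟨rfl, rfl⟩ := h
      rw [P.reglue_thetaLocal_self _ _ R hst hHul hHas]
      exact WithTop.coe_ne_top
    · rw [P.reglue_thetaLocal_of_ne _ _ R (not_edited_of_ne i₀ vQ₀ h)]
      exact hfin.1 i vQ
  · refine ((hfin.2 i).union (Set.finite_singleton vQ₀)).subset fun vQ hvQ => ?_
    by_cases h : vQ = vQ₀
    · exact Or.inr h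
    · left
      have hne : ¬ (i = i₀ ∧ vQ = vQ₀) := fun h' => h h'.2
      simpa [Function.mem_support, P.reglue_thetaLocal_of_ne _ _ R (not_edited_of_ne i₀ vQ₀ hne)] using hvQ

/-- The label sums `Σ_{v_ℚ}` of local Θ-volumes are unchanged at the labels `j ≠ j₀`. [folklore] -/
theorem reglue_finsum_of_ne {i : Fin T.lstar} (hi : i ≠ i₀) :
    (∑ᶠ vQ : T.VQ, ((P.reglue (labelSucc i₀) vQ₀ R).thetaLocal (labelSucc i) vQ).untopD 0) =
      ∑ᶠ vQ : T.VQ, (P.thetaLocal (labelSucc i) vQ).untopD 0 := by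
  refine finsum_congr fun vQ => ?_
  rw [P.reglue_thetaLocal_of_ne _ _ R (not_edited_of_ne i₀ vQ₀ fun h => hi h.1)]

/-- The label sum at `j₀` moves by `logvol(R) − (old local volume)`. [folklore] -/
theorem reglue_finsum_self (hfin : P.ThetaFinite)
    (hst : ∀ Φ ∈ indGroup S, Φ (labelSucc i₀) vQ₀ '' R (labelSucc i₀) vQ₀ = R (labelSucc i₀) vQ₀)
    (hHul : R (labelSucc i₀) vQ₀ ∈ (P.frame (labelSucc i₀) vQ₀).Hul)
    (hHas : (P.frame (labelSucc i₀) vQ₀).HasHull (R (labelSucc i₀) vQ₀)) :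
    (∑ᶠ vQ : T.VQ, ((P.reglue (labelSucc i₀) vQ₀ R).thetaLocal (labelSucc i₀) vQ).untopD 0) =
      (∑ᶠ vQ : T.VQ, (P.thetaLocal (labelSucc i₀) vQ).untopD 0) +
        ((S.D P.n).logvol (labelSucc i₀) vQ₀ (R (labelSucc i₀) vQ₀) -
          (P.thetaLocal (labelSucc i₀) vQ₀).untopD 0) := by
  set a : ℝ := (P.thetaLocal (labelSucc i₀) vQ₀).untopD 0 with ha
  set b : ℝ := (S.D P.n).logvol (labelSucc i₀) vQ₀ (R (labelSucc i₀) vQ₀) with hb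
  have hpt : (fun vQ : T.VQ => ((P.reglue (labelSucc i₀) vQ₀ R).thetaLocal (labelSucc i₀) vQ).untopD 0) =
      fun vQ => (P.thetaLocal (labelSucc i₀) vQ).untopD 0 + (if vQ = vQ₀ then b - a else 0) := by
    funext vQ
    by_cases h : vQ = vQ₀
    · subst h
      rw [if_pos rfl, P.reglue_thetaLocal_self _ _ R hst hHul hHas, WithTop.untopD_coe, ← ha]
      ring
    · have hne : ¬ (i₀ = i₀ ∧ vQ = vQ₀) := fun h' => h h'.2
      rw [if_neg h, P.reglue_thetaLocal_of_ne _ _ R (not_edited_of_ne i₀ vQ₀ hne), add_zero]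
  rw [hpt, finsum_add_distrib (hfin.2 i₀)]
  · rw [finsum_eq_single _ vQ₀ (fun vQ hvQ => if_neg hvQ), if_pos rfl]
  · exact (Set.finite_singleton vQ₀).subset fun vQ hvQ => by
      by_contra h
      exact hvQ (if_neg h)

/-- **The exact effect of the re-gluing on `−|log(Θ)|`**: with `−|log(Θ)|(P) = ν ∈ ℝ` (`ThetaFinite`), the re-glued
setting has `−|log(Θ)| = ν + (logvol(R) − old local volume at (j₀, v_ℚ⁰)) / l⋇` (procession normalisation =
the average over `j ∈ 𝔽_l^⋇`, Prop. 3.9 (i)). [folklore] -/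
theorem reglue_negLogTheta (hfin : P.ThetaFinite)
    (hst : ∀ Φ ∈ indGroup S, Φ (labelSucc i₀) vQ₀ '' R (labelSucc i₀) vQ₀ = R (labelSucc i₀) vQ₀)
    (hHul : R (labelSucc i₀) vQ₀ ∈ (P.frame (labelSucc i₀) vQ₀).Hul)
    (hHas : (P.frame (labelSucc i₀) vQ₀).HasHull (R (labelSucc i₀) vQ₀)) :
    (P.reglue (labelSucc i₀) vQ₀ R).negLogTheta =
      ((processionNormalized (fun i : Fin T.lstar =>
            ∑ᶠ vQ : T.VQ, (P.thetaLocal (labelSucc i) vQ).untopD 0) +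
          ((S.D P.n).logvol (labelSucc i₀) vQ₀ (R (labelSucc i₀) vQ₀) -
              (P.thetaLocal (labelSucc i₀) vQ₀).untopD 0) / (T.lstar : ℝ) : ℝ) : WithTop ℝ) := by
  unfold negLogTheta
  rw [if_pos (reglue_thetaFinite i₀ vQ₀ R hfin hst hHul hHas)]
  congr 1
  set d : ℝ := (S.D P.n).logvol (labelSucc i₀) vQ₀ (R (labelSucc i₀) vQ₀) -
    (P.thetaLocal (labelSucc i₀) vQ₀).untopD 0 with hd
  have hlab : (fun i : Fin T.lstar =>
      ∑ᶠ vQ : T.VQ, ((P.reglue (labelSucc i₀) vQ₀ R).thetaLocal (labelSucc i) vQ).untopD 0) =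
      fun i => (∑ᶠ vQ : T.VQ, (P.thetaLocal (labelSucc i) vQ).untopD 0) + (if i = i₀ then d else 0) := by
    funext i
    by_cases hi : i = i₀
    · subst hi
      rw [if_pos rfl, reglue_finsum_self i vQ₀ R hfin hst hHul hHas]
    · rw [if_neg hi, reglue_finsum_of_ne i₀ vQ₀ R hi, add_zero]
  rw [hlab]
  unfold processionNormalized
  rw [Finset.sum_add_distrib, Finset.sum_ite_eq' Finset.univ i₀ (fun _ => d), if_pos (Finset.mem_univ _),
    add_div]

end AtLabel

/-! ## 3. The hypothesis on the frame at one packet -/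

/-- **Small stable hull-sets at the packet `(j, v_ℚ)`** (HYPOTHESIS of this cell's analysis, never asserted):
the hull frame carries (Ind1),(Ind2)-STABLE hull-sets admitting a hull of ARBITRARILY NEGATIVE mono-analytic
log-volume — the shape of the hull-sets `λ·𝒪_{(−)}` of [IUTchIII] Rmk. 3.9.5 (i) as `λ → 0` (stable under the
permutations of capsule indices and the `{±1}`/unit actions generating (Ind1), (Ind2)). Discharged here for NO
instance (the two-hull-set toy frames of the witnesses of record do not satisfy it; the real frames are
c312-6/c312-7's). [claim: Mochizuki2012, status: disputed] -/
def SmallStableHullSets (j : T.Label) (vQ : T.VQ) : Prop :=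
  ∀ c : ℝ, ∃ R₀ : Set (S.L.Packet j vQ), R₀ ∈ (P.frame j vQ).Hul ∧ (P.frame j vQ).HasHull R₀ ∧
    (∀ Φ ∈ indGroup S, Φ j vQ '' R₀ = R₀) ∧ (S.D P.n).logvol j vQ R₀ < c

open scoped Classical in
/-- The family of regions editing only the packet `(j₀, vQ₀)` to `R₀` (elsewhere `∅`, never read). [folklore] -/
def familyOf (j₀ : T.Label) (vQ₀ : T.VQ) (R₀ : Set (S.L.Packet j₀ vQ₀)) :
    ∀ (j : T.Label) (vQ : T.VQ), Set (S.L.Packet j vQ) :=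
  Function.update (fun (j : T.Label) (vQ : T.VQ) => (∅ : Set (S.L.Packet j vQ))) j₀
    (Function.update (fun vQ : T.VQ => (∅ : Set (S.L.Packet j₀ vQ))) vQ₀ R₀)

/-- The family reads `R₀` at the edited packet. [folklore] -/
theorem familyOf_self (j₀ : T.Label) (vQ₀ : T.VQ) (R₀ : Set (S.L.Packet j₀ vQ₀)) :
    familyOf (S := S) j₀ vQ₀ R₀ j₀ vQ₀ = R₀ := by
  simp [familyOf]

end Setting

end Cor312

/-! ## 4. The bridge hypotheses survive; the Corollary fails after a small re-gluing — for EVERY Thm 3.11 instance -/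

namespace Cor312Vol

open Thm311 Cor312 Cor312.Setting Literature.IUT.LogThetaLattice

variable {T : ThetaIndex} {S : Situation T} {P : Cor312.Setting S}

open scoped Classical in
/-- **The bridge hypotheses survive re-gluing** at one packet by an (Ind1),(Ind2)-stable hull-set admitting a
hull (monotonicity and frames untouched; the one new possible image is an admissible nonempty hull-set; finite
support of global image choices changes at one index at most; `ThetaFinite` by `reglue_thetaFinite`). [folklore] -/
theorem reglue_bridgeHyps (H : BridgeHyps P) (i₀ : Fin T.lstar) (vQ₀ : T.VQ)
    (R : ∀ (j : T.Label) (vQ : T.VQ), Set (S.L.Packet j vQ))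
    (hst : ∀ Φ ∈ indGroup S, Φ (labelSucc i₀) vQ₀ '' R (labelSucc i₀) vQ₀ = R (labelSucc i₀) vQ₀)
    (hHul : R (labelSucc i₀) vQ₀ ∈ (P.frame (labelSucc i₀) vQ₀).Hul)
    (hHas : (P.frame (labelSucc i₀) vQ₀).HasHull (R (labelSucc i₀) vQ₀)) :
    BridgeHyps (P.reglue (labelSucc i₀) vQ₀ R) where
  mono := H.mono
  image_adm := fun i vQ U hU => by
    by_cases h : i = i₀ ∧ vQ = vQ₀
    · obtain ⟨rfl, rfl⟩ := h
      rw [P.reglue_possibleImages_self _ _ R hst, Set.mem_singleton_iff] at hU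
      subst hU
      exact P.hul_adm _ _ _ hHul
    · rw [P.reglue_possibleImages_of_ne _ _ R (not_edited_of_ne i₀ vQ₀ h)] at hU
      exact H.image_adm i vQ U hU
  image_fin := fun U => by
    -- replace the value at the edited index by a possible image of `P`; off that index `U` is a choice for `P`
    have hf : ∀ t : Fin T.lstar × T.VQ,
        (if t = (i₀, vQ₀) then P.thetaRegion3 (labelSucc t.1) t.2 else U.1 t) ∈
          P.possibleImages (labelSucc t.1) t.2 := by
      intro t
      by_cases ht : t = (i₀, vQ₀)
      · rw [if_pos ht]
        exact P.thetaRegion3_mem_possibleImages _ _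
      · rw [if_neg ht]
        have hne : ¬ (t.1 = i₀ ∧ t.2 = vQ₀) := fun h => ht (Prod.ext h.1 h.2)
        have hU := U.2 t
        rw [P.reglue_possibleImages_of_ne _ _ R (not_edited_of_ne i₀ vQ₀ hne)] at hU
        exact hU
    let U' : ImageChoice P :=
      ⟨fun t => if t = (i₀, vQ₀) then P.thetaRegion3 (labelSucc t.1) t.2 else U.1 t, hf⟩
    refine ((H.image_fin U').union (Set.finite_singleton (i₀, vQ₀))).subset fun t ht => ?_
    by_cases h : t = (i₀, vQ₀)
    · exact Or.inr h
    · left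
      rw [Function.mem_support] at ht ⊢
      have hU' : U'.1 t = U.1 t := if_neg h
      rw [hU']
      exact ht
  hul_nonempty := H.hul_nonempty
  theta_nonempty := fun i vQ => by
    by_cases h : i = i₀ ∧ vQ = vQ₀
    · obtain ⟨rfl, rfl⟩ := h
      rw [P.reglue_thetaRegion3_self _ _ R]
      exact H.hul_nonempty _ _ _ hHul
    · rw [P.reglue_thetaRegion3_of_ne _ _ R (not_edited_of_ne i₀ vQ₀ h)]
      exact H.theta_nonempty i vQ
  finite := reglue_thetaFinite i₀ vQ₀ R H.finite hst hHul hHas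

/-- **Re-gluing ONE packet falsifies the typed Corollary 3.12**: for every setting `P` with `BridgeHyps P` and
`AbsLogQPos P`, at any packet `(labelSucc i₀, v_ℚ⁰)` with `SmallStableHullSets`, some re-gluing of `P` at that
single packet (`P.reglue …`: every other field and the underlying `Thm311.Situation` unchanged) satisfies every
bridge hypothesis and `|log(q)| > 0` and VIOLATES `Statement`. [folklore] -/
theorem exists_reglue_not_statement (H : BridgeHyps P) (hq : P.AbsLogQPos) (i₀ : Fin T.lstar) (vQ₀ : T.VQ)
    (hsmall : P.SmallStableHullSets (labelSucc i₀) vQ₀) :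
    ∃ R : ∀ (j : T.Label) (vQ : T.VQ), Set (S.L.Packet j vQ),
      BridgeHyps (P.reglue (labelSucc i₀) vQ₀ R) ∧ (P.reglue (labelSucc i₀) vQ₀ R).AbsLogQPos ∧
        ¬ (P.reglue (labelSucc i₀) vQ₀ R).Statement := by
  -- the finite value of `−|log(Θ)|(P)` and the local volume to be replaced
  set ν : ℝ := processionNormalized (fun i : Fin T.lstar =>
    ∑ᶠ vQ : T.VQ, (P.thetaLocal (labelSucc i) vQ).untopD 0) with hν
  set a : ℝ := (P.thetaLocal (labelSucc i₀) vQ₀).untopD 0 with ha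
  have hl : (0 : ℝ) < (T.lstar : ℝ) := by
    have := T.two_le_lstar
    exact_mod_cast (by omega : 0 < T.lstar)
  -- a stable hull-set of log-volume `b < a + l⋇ · (−|log(q)| − ν)`
  obtain ⟨R₀, hHul₀, hHas₀, hst₀, hb₀⟩ := hsmall (a + (T.lstar : ℝ) * (P.negLogQ - ν))
  refine ⟨familyOf (labelSucc i₀) vQ₀ R₀, ?_, ?_, ?_⟩
  all_goals first
    | (have hR : familyOf (S := S) (labelSucc i₀) vQ₀ R₀ (labelSucc i₀) vQ₀ = R₀ := familyOf_self _ _ _)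
  · exact reglue_bridgeHyps H i₀ vQ₀ _ (by rw [hR]; exact hst₀) (by rw [hR]; exact hHul₀)
      (by rw [hR]; exact hHas₀)
  · exact (P.reglue_absLogQPos_iff _ _ _).2 hq
  · rintro ⟨-, hle⟩
    rw [P.reglue_negLogQ, reglue_negLogTheta i₀ vQ₀ _ H.finite (by rw [hR]; exact hst₀)
      (by rw [hR]; exact hHul₀) (by rw [hR]; exact hHas₀), WithTop.coe_le_coe, hR, ← hν, ← ha] at hle
    -- `−|log(q)| ≤ ν + (b − a)/l⋇` with `b < a + l⋇ (−|log(q)| − ν)` is absurd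
    have h1 : ((S.D P.n).logvol (labelSucc i₀) vQ₀ R₀ - a) / (T.lstar : ℝ) < P.negLogQ - ν := by
      rw [div_lt_iff₀ hl]
      linarith
    linarith

/-- **The (G3) countermodel is UNIFORM in the Theorem 3.11 instance**: for EVERY `T`, EVERY
`F : Thm311.FullSituation T` (degenerate or contentful, `F.Statement` or not) and EVERY setting `P` over `F` with
the bridge hypotheses, `|log(q)| > 0` and small stable hull-sets at one packet, a setting over THE SAME `F`
differing from `P` only in the Θ-glue at that packet satisfies every bridge hypothesis and `|log(q)| > 0` and
violates the typed Corollary 3.12 — so no property of the Theorem 3.11 instance alone entails the Corollary; a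
constraint tying `thetaRegionOf` to the column/link data (the shape of `Cor312Vol.SoundAtInput`) is needed.
Interface-level; no judgement on the intended glue. [claim: Mochizuki2012, status: disputed] -/
theorem thm311_any_instance_not_imp_statement (F : FullSituation T)
    (P : Cor312.Setting F.toLatticeSituation.toSituation) (H : BridgeHyps P) (hq : P.AbsLogQPos)
    (i₀ : Fin T.lstar) (vQ₀ : T.VQ) (hsmall : P.SmallStableHullSets (labelSucc i₀) vQ₀) :
    ∃ P' : Cor312.Setting F.toLatticeSituation.toSituation,
      (∃ R, P' = P.reglue (labelSucc i₀) vQ₀ R) ∧ BridgeHyps P' ∧ P'.AbsLogQPos ∧ ¬ P'.Statement := by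
  obtain ⟨R, hB, hq', hns⟩ := exists_reglue_not_statement H hq i₀ vQ₀ hsmall
  exact ⟨P.reglue (labelSucc i₀) vQ₀ R, ⟨R, rfl⟩, hB, hq', hns⟩

end Cor312Vol

end IUTFork

end Summit.ABC

end
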